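import Summits.BirchSwinnertonDyer.BirchSwinnertonDyer.Theorems.RamifiedHeegnerPairLeafPartnerOrdersULevelModel
import Literature.NumberTheory.Automorphic.QuaternionSubidealCount
import HarnessLib

/-!
# Route `RamifiedHeegnerPair`, crux U₁ `LeafRankOneUpperAtThree` (stmt-BirchSwinnertonDyer-26022), line `partnerdescent` —
# the Hecke–Atkin–Lehner twist (HT) from the tree, part 3: the forward condition `Brandt.IsForward` is LOCAL at `ℓ`, and in the
# oriented level model it reads «the `(0,0)` entry of the local generator is a unit»

HONEST FRAMING. Theorems only; helper file (`--supports stmt-BirchSwinnertonDyer-26022`); local algebra over the tree's Brandt layer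
(‹BrandtEichlerLevelUOperators› `Brandt.IsForward`, ‹LatticeLocalGlobal›, the oriented level model of part 2
‹…LeafPartnerOrdersULevelModel›); no named fact, no `sorry`; nothing booked; BSD is proved for no curve.
Lead prover bsd-line-rhp-p2 g65, 2026-08-31.

WHAT. For a Brandt setup `S` with chosen orientation `(S.O₁, S.O₂)` and a prime `ℓ`:
* `isForward_iff_local` — for lattices `J ⊆ I` of `ℓ`-power index with `I₍ℓ₎ = α O₍ℓ₎`: `IsForward O₁ O₂ ℓ J I` iff
  `¬ (α⁻¹ J₍ℓ₎) · 𝒯₍ℓ₎ ⊆ ℓ · O₁,₍ℓ₎` (`𝒯 = link(O₁, O₂)`; inclusion of lattices is local, and at `q ≠ ℓ` it is automatic);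
* `units_smul_localAt_mul_link_le_iff` — in an oriented level model `Φ` of level `ℓ^e`, `e ≥ 1`, for `z ∈ O₍ℓ₎`:
  `(z O₍ℓ₎) 𝒯₍ℓ₎ ⊆ ℓ O₁,₍ℓ₎ ↔ ‖(Φ z)₀₀‖ < 1` (the module docstring of ‹BrandtEichlerLevelUOperators›: «exactly the forward ones
  satisfy `M₂' ⊄ ℓ M₁`», here in matrix form);
* `isForward_iff_norm_eq_one` — hence `IsForward O₁ O₂ ℓ J I ↔ ‖(Φ z)₀₀‖ = 1` for the local generator `z` of `α⁻¹ J₍ℓ₎`.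
[cite: BertoliniDarmon2001, §3.1 p. 127, §4.1 pp. 142–144] [cite: VignerasLNM800, Ch. II §2]
-/

set_option linter.dupNamespace false
set_option autoImplicit false

noncomputable section

namespace Summit.BirchSwinnertonDyer.BirchSwinnertonDyer.Theorems.LeafPartnerOrders

open scoped Pointwise
open Literature.NumberTheory.Automorphic Literature.NumberTheory.Automorphic.Brandt
  Literature.NumberTheory.Automorphic.AtkinLehner

variable {Nplus Nminus : ℕ} (S : XiSetup Nplus Nminus)

/-! ### Localisation bookkeeping for `ℓ · L` -/

section SmulLocal

variable {V : Type*} [AddCommGroup V] [Module ℚ V]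

omit [Module ℚ V] in
/-- At a prime `q` not dividing `m`, `(m · L)₍q₎ = L₍q₎`. [folklore] -/
theorem localAt_natCast_smul_of_coprime (L : Submodule ℤ V) {m q : ℕ} (hm0 : m ≠ 0) (hmq : m.Coprime q) :
    localAt q (((m : ℕ) : ℤ) • L) = localAt q L :=
  (localAt_eq_of_smul_le (L := L) (L' := ((m : ℕ) : ℤ) • L)
    (fun x hx ↦ by
      obtain ⟨y, hy, rfl⟩ := (Submodule.mem_smul_pointwise_iff_exists x _ L).mp hx
      exact L.smul_mem _ hy) hm0 hmq
    (fun x hx ↦ Submodule.smul_mem_pointwise_smul x _ L hx)).symm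

/-- At any `q`, `(m · L)₍q₎ = m · L₍q₎`. [folklore] -/
theorem localAt_natCast_smul (L : Submodule ℤ V) (m : ℕ) (q : ℕ) :
    localAt q (((m : ℕ) : ℤ) • L) = ((m : ℕ) : ℤ) • localAt q L := by
  ext x
  constructor
  · rintro ⟨c, hc0, hc, hcx⟩
    obtain ⟨y, hy, hyx⟩ := (Submodule.mem_smul_pointwise_iff_exists _ _ L).mp hcx
    refine (Submodule.mem_smul_pointwise_iff_exists x _ _).mpr ⟨(c : ℚ)⁻¹ • y, inv_smul_mem_localAt hc0 hc (le_localAt q L hy), ?_⟩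
    have h : ((m : ℕ) : ℤ) • y = (c : ℤ) • x := hyx
    rw [smul_comm, h, inv_smul_natCast_zsmul hc0]
  · intro hx
    obtain ⟨y, ⟨c, hc0, hc, hcy⟩, rfl⟩ := (Submodule.mem_smul_pointwise_iff_exists x _ _).mp hx
    refine ⟨c, hc0, hc, ?_⟩
    rw [smul_comm]
    exact Submodule.smul_mem_pointwise_smul _ _ L hcy

end SmulLocal

/-! ### The forward condition is local at `ℓ` -/

/-- `O₍q₎ · O₁,₍q₎ = O₁,₍q₎` (`O ⊆ O₁` orders). [folklore] -/
theorem localAt_O_mul_localAt_O₁ (q : ℕ) : localAt q S.O * localAt q S.O₁ = localAt q S.O₁ := by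
  refine le_antisymm (Submodule.mul_le.mpr fun a ha b hb ↦ ?_) fun x hx ↦ ?_
  · exact mul_mem_localAt S.isOrder_O₁.mul_mem q (localAt_mono q S.O_le_O₁ ha) hb
  · rw [← one_mul x]
    exact Submodule.mul_mem_mul (le_localAt q S.O S.isEichlerOrder.isOrder.one_mem) hx

/-- **The forward condition is local at `ℓ`.** For lattices `J ⊆ I` of `ℓ`-power index and `I₍ℓ₎ = α O₍ℓ₎`:
`IsForward O₁ O₂ ℓ J I ↔ ¬ (α⁻¹ J₍ℓ₎) 𝒯₍ℓ₎ ⊆ ℓ O₁,₍ℓ₎`, `𝒯 = link(O₁, O₂)` (inclusion of lattices is tested prime by prime; at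
`q ≠ ℓ` one has `J₍q₎ = I₍q₎`, `𝒯 ⊆ O₁` and `(ℓ I O₁)₍q₎ = (I O₁)₍q₎`, so only `q = ℓ` matters). [cite: BertoliniDarmon2001, §4.1 pp. 142–144] -/
theorem isForward_iff_local {ℓ : ℕ} [hℓ : Fact ℓ.Prime] {J I : Submodule ℤ S.D} (hJI : J ≤ I) {j : ℕ}
    (hidx : J.toAddSubgroup.relIndex I.toAddSubgroup = ℓ ^ j) {α : S.Dˣ} (hα : localAt ℓ I = α • localAt ℓ S.O) :
    IsForward S.O₁ S.O₂ ℓ J I ↔ ¬ (α⁻¹ • localAt ℓ J) * localAt ℓ (link S.O₁ S.O₂) ≤ ((ℓ : ℕ) : ℤ) • localAt ℓ S.O₁ := by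
  rw [isForward_iff, not_iff_not]
  have hℓ0 : ℓ ≠ 0 := hℓ.out.ne_zero
  -- the inclusion at `ℓ`, translated by `α⁻¹`
  have hloc : localAt ℓ (J * link S.O₁ S.O₂) ≤ localAt ℓ (((ℓ : ℕ) : ℤ) • (I * S.O₁)) ↔
      (α⁻¹ • localAt ℓ J) * localAt ℓ (link S.O₁ S.O₂) ≤ ((ℓ : ℕ) : ℤ) • localAt ℓ S.O₁ := by
    rw [← localAt_mul_localAt_eq, localAt_natCast_smul, ← localAt_mul_localAt_eq, hα, ← units_smul_mul,
      localAt_O_mul_localAt_O₁, ← units_smul_le_units_smul_iff α⁻¹, units_smul_mul, units_smul_zsmul, inv_smul_smul]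
  rw [← hloc, le_iff_forall_prime_localAt_le]
  constructor
  · exact fun h ↦ h ℓ hℓ.out
  · intro h q hq
    by_cases hqℓ : q = ℓ
    · subst hqℓ; exact h
    · -- at `q ≠ ℓ` the inclusion is automatic
      have hcop : ℓ.Coprime q := (Nat.coprime_primes hℓ.out hq).mpr (Ne.symm hqℓ)
      rw [← localAt_mul_localAt_eq, localAt_eq_of_relIndex_eq_prime_pow hJI hidx hℓ.out hq hqℓ,
        localAt_natCast_smul_of_coprime _ hℓ0 hcop, ← localAt_mul_localAt_eq]
      exact mul_le_mul' le_rfl (localAt_mono q (link_le_left S.O₁ S.O₂))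

/-! ### The forward condition in the oriented level model -/

section Model

variable {S}
variable {ℓ : ℕ} [hℓ : Fact ℓ.Prime] {e : ℕ} (Φ : S.D →ₐ[ℚ] Matrix (Fin 2) (Fin 2) ℚ_[ℓ])
  (hΦ₁ : ∀ x : S.D, x ∈ localAt ℓ S.O₁ ↔ ∀ i j, ‖Φ x i j‖ ≤ 1)
  (hΦ : ∀ x : S.D, x ∈ localAt ℓ S.O ↔ IsLevelShape e (Φ x))

/-- `0 < ℓ^{-e}`. [folklore] -/
private theorem zpow_neg_pos_g65' (e : ℕ) : 0 < (ℓ : ℝ) ^ (-(e : ℤ)) := zpow_pos (by exact_mod_cast hℓ.out.pos) _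

/-- `ℓ^{-e} ≤ ℓ⁻¹` for `e ≥ 1`. [folklore] -/
theorem zpow_neg_le_inv_g65 (he : 1 ≤ e) : (ℓ : ℝ) ^ (-(e : ℤ)) ≤ (ℓ : ℝ)⁻¹ := by
  rw [← zpow_neg_one]
  exact zpow_le_zpow_right₀ (by exact_mod_cast hℓ.out.one_lt.le) (by omega)

omit hℓ in
/-- In `ℚ_ℓ`: `‖x‖ < 1 ↔ ‖x‖ ≤ ℓ⁻¹`. [folklore] -/
theorem Padic.norm_lt_one_iff_le_inv [Fact ℓ.Prime] (x : ℚ_[ℓ]) : ‖x‖ < 1 ↔ ‖x‖ ≤ (ℓ : ℝ)⁻¹ := by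
  rw [← zpow_neg_one, Padic.norm_le_pow_iff_norm_lt_pow_add_one]
  norm_num

include hΦ₁ hΦ in
/-- **Level-shaped times link-shaped is link-shaped**: for `o ∈ O₍ℓ₎` and `t ∈ 𝒯₍ℓ₎`, `o t ∈ 𝒯₍ℓ₎` in the model (second row in `ℓ^e ℤ_ℓ`).
[folklore] -/
theorem mul_mem_localAt_link {o t : S.D} (ho : o ∈ localAt ℓ S.O) (ht : t ∈ localAt ℓ (link S.O₁ S.O₂)) :
    o * t ∈ localAt ℓ (link S.O₁ S.O₂) := by
  set r := (ℓ : ℝ) ^ (-(e : ℤ))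
  have hr0 := zpow_neg_pos_g65' (ℓ := ℓ) e
  obtain ⟨hoint, ho10⟩ := (hΦ o).mp ho
  obtain ⟨htint, ht10, ht11⟩ := (mem_localAt_link_iff_shape Φ hΦ₁ hΦ t).mp ht
  rw [mem_localAt_link_iff_shape Φ hΦ₁ hΦ, map_mul]
  refine ⟨fun i j ↦ Padic.norm_mul_apply_le_one hoint htint i j, ?_, ?_⟩
  · rw [mul_apply_one_zero]
    exact norm_add_mul_le' ((mul_le_mul ho10 (htint 0 0) (norm_nonneg _) hr0.le).trans (mul_one r).le)
      ((mul_le_mul (hoint 1 1) ht10 (norm_nonneg _) zero_le_one).trans (one_mul r).le)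
  · rw [Matrix.mul_apply, Fin.sum_univ_two]
    exact norm_add_mul_le' ((mul_le_mul ho10 (htint 0 1) (norm_nonneg _) hr0.le).trans (mul_one r).le)
      ((mul_le_mul (hoint 1 1) ht11 (norm_nonneg _) zero_le_one).trans (one_mul r).le)

include hΦ₁ hΦ in
/-- **The forward condition in the model.** For `e ≥ 1` and a unit `z ∈ O₍ℓ₎`: `(z O₍ℓ₎) 𝒯₍ℓ₎ ⊆ ℓ O₁,₍ℓ₎ ↔ ‖(Φ z)₀₀‖ < 1`
(`⇒`: test on `t ∈ 𝒯₍ℓ₎` with `Φ t ≡ E₀₀ (mod ℓ^e)`; `⇐`: the four entries of `Φ(z o t)` lie in `ℓ ℤ_ℓ`). So the local right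
ideal `z O₍ℓ₎`, as a pair of lattices `(z L₁, z L₂)`, is NOT forward exactly when `z L₂ ⊆ ℓ L₁`. [cite: BertoliniDarmon2001, §4.1 pp. 142–144] -/
theorem units_smul_localAt_mul_link_le_iff (he : 1 ≤ e) {z : S.Dˣ} (hz : (z : S.D) ∈ localAt ℓ S.O) :
    (z • localAt ℓ S.O) * localAt ℓ (link S.O₁ S.O₂) ≤ ((ℓ : ℕ) : ℤ) • localAt ℓ S.O₁ ↔ ‖Φ z 0 0‖ < 1 := by
  set r := (ℓ : ℝ) ^ (-(e : ℤ))
  have hr0 := zpow_neg_pos_g65' (ℓ := ℓ) e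
  have hr1 := zpow_neg_le_one' (ℓ := ℓ) e
  have hre := zpow_neg_le_inv_g65 (ℓ := ℓ) (e := e) he
  have hinv1 : (ℓ : ℝ)⁻¹ ≤ 1 := inv_le_one_of_one_le₀ (by exact_mod_cast hℓ.out.one_lt.le)
  obtain ⟨hzint, hz10⟩ := (hΦ z).mp hz
  constructor
  · intro hle
    -- a test element `t ∈ 𝒯₍ℓ₎` with `Φ t ≡ E₀₀ (mod ℓ^e)`
    obtain ⟨t, ht⟩ := AlgHom.exists_norm_sub_le Φ (Matrix.single 0 0 (1 : ℚ_[ℓ])) e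
    set Δ := Φ t - Matrix.single 0 0 (1 : ℚ_[ℓ]) with hΔ
    have hΦt : Φ t = Matrix.single 0 0 (1 : ℚ_[ℓ]) + Δ := by rw [hΔ]; abel
    have htT : t ∈ localAt ℓ (link S.O₁ S.O₂) := by
      rw [mem_localAt_link_iff_shape Φ hΦ₁ hΦ]
      refine ⟨fun i j ↦ ?_, ?_, ?_⟩
      · rw [hΦt, Matrix.add_apply]
        refine (IsUltrametricDist.norm_add_le_max _ _).trans (max_le ?_ ((ht i j).trans hr1))
        rw [Matrix.single_apply]
        split_ifs <;> simp
      · rw [hΦt, Matrix.add_apply, Matrix.single_apply, if_neg (by simp), zero_add]; exact ht 1 0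
      · rw [hΦt, Matrix.add_apply, Matrix.single_apply, if_neg (by simp), zero_add]; exact ht 1 1
    have hzt : (z : S.D) * t ∈ ((ℓ : ℕ) : ℤ) • localAt ℓ S.O₁ := by
      refine hle (Submodule.mul_mem_mul ?_ htT)
      rw [mem_units_smul_submodule_iff, Units.smul_def, smul_eq_mul, Units.inv_mul]
      exact le_localAt ℓ S.O S.isEichlerOrder.isOrder.one_mem
    have h00 := (mem_smul_localAt_O₁_iff_shape Φ hΦ₁ _).mp hzt 0 0
    rw [map_mul, Matrix.mul_apply, Fin.sum_univ_two, hΦt, Matrix.add_apply, Matrix.add_apply, Matrix.single_apply,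
      Matrix.single_apply, if_pos ⟨rfl, rfl⟩, if_neg (by simp), zero_add] at h00
    have herr : ‖Φ z 0 0 * Δ 0 0 + Φ z 0 1 * Δ 1 0‖ ≤ (ℓ : ℝ)⁻¹ :=
      norm_add_mul_le' ((mul_le_mul (hzint 0 0) ((ht 0 0).trans hre) (norm_nonneg _) zero_le_one).trans (one_mul _).le)
        ((mul_le_mul (hzint 0 1) ((ht 1 0).trans hre) (norm_nonneg _) zero_le_one).trans (one_mul _).le)
    have e1 : Φ z 0 0 = (Φ z 0 0 * (1 + Δ 0 0) + Φ z 0 1 * Δ 1 0) - (Φ z 0 0 * Δ 0 0 + Φ z 0 1 * Δ 1 0) := by ring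
    rw [Padic.norm_lt_one_iff_le_inv, e1, sub_eq_add_neg]
    exact (IsUltrametricDist.norm_add_le_max _ _).trans (max_le h00 (by rw [norm_neg]; exact herr))
  · intro h00
    rw [Padic.norm_lt_one_iff_le_inv] at h00
    refine Submodule.mul_le.mpr fun a ha t ht ↦ ?_
    obtain ⟨o, ho, rfl⟩ := (Submodule.mem_smul_pointwise_iff_exists a z _).mp ha
    rw [Units.smul_def, smul_eq_mul, mul_assoc]
    have hot := mul_mem_localAt_link Φ hΦ₁ hΦ ho ht
    obtain ⟨huint, hu10, hu11⟩ := (mem_localAt_link_iff_shape Φ hΦ₁ hΦ _).mp hot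
    rw [mem_smul_localAt_O₁_iff_shape Φ hΦ₁, map_mul]
    set u := Φ (o * t)
    intro i j
    rw [Matrix.mul_apply, Fin.sum_univ_two]
    fin_cases i <;> fin_cases j
    · exact norm_add_mul_le' ((mul_le_mul h00 (huint 0 0) (norm_nonneg _) (by positivity)).trans (mul_one _).le)
        ((mul_le_mul (hzint 0 1) (hu10.trans hre) (norm_nonneg _) zero_le_one).trans (one_mul _).le)
    · exact norm_add_mul_le' ((mul_le_mul h00 (huint 0 1) (norm_nonneg _) (by positivity)).trans (mul_one _).le)
        ((mul_le_mul (hzint 0 1) (hu11.trans hre) (norm_nonneg _) zero_le_one).trans (one_mul _).le)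
    · exact norm_add_mul_le' ((mul_le_mul (hz10.trans hre) (huint 0 0) (norm_nonneg _) (by positivity)).trans (mul_one _).le)
        ((mul_le_mul (hzint 1 1) (hu10.trans hre) (norm_nonneg _) zero_le_one).trans (one_mul _).le)
    · exact norm_add_mul_le' ((mul_le_mul (hz10.trans hre) (huint 0 1) (norm_nonneg _) (by positivity)).trans (mul_one _).le)
        ((mul_le_mul (hzint 1 1) (hu11.trans hre) (norm_nonneg _) zero_le_one).trans (one_mul _).le)

include hΦ₁ hΦ in
/-- **The forward condition is «`(0,0)` entry a unit».** For `e ≥ 1`, lattices `J ⊆ I` of `ℓ`-power index with `I₍ℓ₎ = α O₍ℓ₎` and a local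
generator `z ∈ O₍ℓ₎` of `α⁻¹ J₍ℓ₎ = z O₍ℓ₎`: `IsForward O₁ O₂ ℓ J I ↔ ‖(Φ z)₀₀‖ = 1`. [cite: BertoliniDarmon2001, §4.1 pp. 142–144] -/
theorem isForward_iff_norm_eq_one (he : 1 ≤ e) {J I : Submodule ℤ S.D} (hJI : J ≤ I) {j : ℕ}
    (hidx : J.toAddSubgroup.relIndex I.toAddSubgroup = ℓ ^ j) {α : S.Dˣ} (hα : localAt ℓ I = α • localAt ℓ S.O)
    {z : S.Dˣ} (hz : (z : S.D) ∈ localAt ℓ S.O) (hJz : α⁻¹ • localAt ℓ J = z • localAt ℓ S.O) :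
    IsForward S.O₁ S.O₂ ℓ J I ↔ ‖Φ z 0 0‖ = 1 := by
  rw [isForward_iff_local S hJI hidx hα, hJz, units_smul_localAt_mul_link_le_iff Φ hΦ₁ hΦ he hz, not_lt]
  have h1 : ‖Φ z 0 0‖ ≤ 1 := ((hΦ z).mp hz).1 0 0
  exact ⟨fun h ↦ le_antisymm h1 h, fun h ↦ h.ge⟩

end Model

end Summit.BirchSwinnertonDyer.BirchSwinnertonDyer.Theorems.LeafPartnerOrders

end
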